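import Summits.BirchSwinnertonDyer.Rank1Residual.Additive.KatoDescentPerrinRiouRatioOfAugmentation
import Summits.BirchSwinnertonDyer.Rank1Residual.Additive.KatoDescentKatoRigidPointValues
import Summits.BirchSwinnertonDyer.Rank1Residual.Additive.KatoDescentKatoRigidSeparation
import Summits.BirchSwinnertonDyer.BirchSwinnertonDyer.Theorems.CyclotomicUntwistRohrlichAtLevel
import Literature.NumberTheory.GaloisRepresentations.ImaginaryQuadraticCyclotomicProofs
import Literature.NumberTheory.EllipticCurves.ModularSymbolsHeckeProofs
import Literature.NumberTheory.EllipticCurves.PAdicPowerSeriesInterpolationAgreementProofs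
import Literature.NumberTheory.EllipticCurves.LeadingTermPPartProofs
import HarnessLib

set_option autoImplicit false

/-!
# The display AUG is a THEOREM: `e·𝒞₁·F(0) = 𝒞₂·G(0)` for two Kato families lifted into one pin; hence
# KATO-RIGID ⟸ Kato's Thm. 12.4 (2), and PR-INV (A2's `hPRinv`) ⟸ {`level_eq_conductorNorm`, Thm. 12.4 (2)}
# (seat `bsd-cm-prr-ty1` g15, cell `bsd-cm`; theorems only: no definition, no named fact, no instance, no `sorry`)

Part 60 — the ASSEMBLY — of the seat's kernel cut of stub 3 of the Kato–Perrin-Riou skeletons v4 (cruxes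
stmt-BirchSwinnertonDyer-19945 / -19223; HOME `bsd-cm-prr-ty1/STUB3-CUT.md` §6 addenda 7–9).  E28
(`katoRigid_of_thm12_4_of_aug`) reduced KATO-RIGID to Kato's Thm. 12.4 (2) (`Kato2004.thm12_4`, a named fact of the tree) and
the display AUG (its hypothesis `hAUG`); E29 (`prInv_of_lev_of_thm12_4_of_aug`) did the same for PR-INV.  THIS FILE PROVES AUG:
★ `aug` — E28's binder `hAUG`, VERBATIM, as a theorem.  Proof (Kato's §13.9 comparison run in `Λ ⊗ ℚ_p`, [Kato2004Asterisque]
p. 230; [MazurTateTeitelbaum1986Invent] §I.13): E44 reads the explicit numbers of the two families by Iwasawa functions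
`Φ₁, Φ₂ ∈ ℤ_p⟦T⟧` (after clearing `p^{v₁}, p^{v₂}`) with constant terms `p^{vᵢ}·qᵢ·𝒸ᵢ·∏_{ℓ ∣ pAᵢ, ℓ ≠ p} P_ℓ(1)`; at every level
`n` a frame rotation `ι₂ ∘ σ_{a_n} = ι₁` is realised by `σ_n ∈ Gal(ℚ̄/ℚ)` (`χ_cyc` onto), and `ℤ_p` being compact the exponents
`κ(σ_n)` have a cluster value `β*` (E45); for each `k` past Rohrlich's bound (the tree's unconditional `rohrlich_primePow_of_isNewformOf`
fed to E42's `exists_bound_continuation_one_ne_zero`: `L(f, χ, 1) ≠ 0` for the faithful characters of `Γ_k`, Shimura's continuation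
`exists_differentiable_eq_twistedLSeries_holds`) E46 produces a point `z_k` of the open unit disc of `ℂ_p`, `z_k + 1` a primitive
`p^k`-th root of unity, where `C(e)·p^{v₂}FΦ₁` and `p^{v₁}GΦ₂(1+T)^{β*}` take a common value; these points are pairwise distinct, so
E40 (`eq_of_infinite_agree`, `p`-adic Weierstrass preparation) gives `C(e)·p^{v₂}FΦ₁ = p^{v₁}GΦ₂(1+T)^{β*}` in `ℚ_p⟦T⟧`; constant
terms, cancellation of `p^{v₁+v₂}` and multiplication by the Euler factor `P_p(1)` give AUG.
★ `katoRigid_of_thm12_4` — KATO-RIGID (E28's conclusion, verbatim) from `Kato2004.thm12_4` ALONE.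
★ `prInv_of_lev_of_thm12_4` — PR-INV = stub 3 (A2's `hPRinv`, verbatim) from `IsNewformOf.level_eq_conductorNorm` and `Kato2004.thm12_4`.
HONEST LABEL: AUG is now PROVED (0 named facts of its own); KATO-RIGID and PR-INV remain CONDITIONAL on Kato's Thm. 12.4 (2)
(`Kato2004.thm12_4`, an unproved named fact of the tree) — and PR-INV also on `level_eq_conductorNorm`; no stub is closed
unconditionally; nothing is asserted on 19945 / 19223; Perrin-Riou's conjecture and Kato's Main Conjecture are untouched; no summit
statement is proved; BSD is not proved for any curve.
References: [Kato2004Asterisque] Thm. 12.4 (2) (p. 221), Thm. 12.5 (p. 222), §13.9–Lemma 13.10 (pp. 229–230);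
[RohrlichInventiones1984] Theorem (p. 409); [Shimura1971] Thm. 3.66; [MazurTateTeitelbaum1986Invent] §I.12–I.14; [Washington1997]
Thm. 2.5, §7.1–§7.3, §13.2; [BlochKato1990] Prop. 3.8.
-/

noncomputable section

open scoped NumberField BigOperators TensorProduct

open WeierstrassCurve Field IsDedekindDomain NumberField Rat.HeightOneSpectrum CongruenceSubgroup ValuativeRel
  Literature.NumberTheory.EllipticCurves Literature.NumberTheory.EllipticCurves.ModularForms
  Literature.NumberTheory.EllipticCurves.Rank1Residual Literature.NumberTheory.EllipticCurves.Rank1Residual.Typed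
  Literature.NumberTheory.EllipticCurves.Kato2004 Literature.NumberTheory.EllipticCurves.IwasawaAlgebra
  Literature.NumberTheory.EllipticCurves.Kato2004.EulerSystemValues
  Literature.NumberTheory.GaloisRepresentations Literature.NumberTheory.GaloisRepresentations.PeriodRingData
  Literature.NumberTheory.GaloisRepresentations.IsNonarchimedeanLocalField Literature.NumberTheory.PAdicHodge
  Literature.NumberTheory.AdelicBaseChange Literature.NumberTheory.Automorphic
open Summit.BirchSwinnertonDyer.BirchSwinnertonDyer.Theorems.CongruentShaFreeCutKatoKummerLogTorsion
open Summit.BirchSwinnertonDyer.Rank1Residual Summit.BirchSwinnertonDyer.Rank1Residual.Additive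

namespace Summit.BirchSwinnertonDyer.Rank1Residual.Additive.PerrinRiouUnit

set_option backward.isDefEq.respectTransparency false in
set_option maxHeartbeats 3200000 in
/-- ★ **AUG** (E28's hypothesis `hAUG`, verbatim, PROVED): for two `ZetaBody` families of a curve with `Λ₂ = e • Λ₁` and Kato's
guards, lifted into one pin `(K, γ, I)` with a collinearity `F • y₁ = G • y₂`, `F(0) ≠ 0 ∨ G(0) ≠ 0`,
`e · (q₁ 𝒸₁ ∏_{ℓ ∣ pA₁} P_ℓ(1)) · F(0) = (q₂ 𝒸₂ ∏_{ℓ ∣ pA₂} P_ℓ(1)) · G(0)` in `ℚ_p`.  See the module docstring for the proof.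
[cite: Kato2004Asterisque, §13.9–Lemma 13.10 (pp. 229–230)] [cite: RohrlichInventiones1984, Theorem (p. 409)]
[cite: MazurTateTeitelbaum1986Invent, §I.13] -/
theorem aug : ∀ (W : WeierstrassCurve ℚ) [W.IsElliptic] [W.IsGloballyMinimal] (p : ℕ) [Fact p.Prime],
      letI : ContinuousSMul ℤ_[p] (W.tateModule p) := TateModule.continuousSMul_padicInt
      letI : Module.Free ℤ_[p] (W.tateModule p) := W.module_free_tateModule_holds p
      letI : Module.Finite ℤ_[p] (W.tateModule p) := W.module_finite_tateModule_holds p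
      ∀ (hp : p ≠ 2) {N : ℕ} [NeZero N] (f : CuspForm (Gamma0 N) 2), IsNewformOf W f →
      ∀ (ι₁ ι₂ : (n : ℕ) → (CyclotomicField n ℚ →+* ℂ)) (q₁ q₂ : ℚ)
        (Λ₁ Λ₂ : ∀ (k : ℕ) (r : Finset (HeightOneSpectrum (𝓞 ℚ))),
          H1 (tateRep W p) (cycSubgroup p k r) →ₗ[ℤ_[p]] ℚ_[p] ⊗[ℚ] CyclotomicField (cycLevel p k r) ℚ) (e : ℚ_[p]),
        q₁ ≠ 0 → q₂ ≠ 0 → e ≠ 0 → (∀ (k : ℕ) (y : H1 (tateRep W p) (cycSubgroup p k ∅)), Λ₂ k ∅ y = e • Λ₁ k ∅ y) →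
      ∀ (c₁ d₁ a₁ : ℤ) (A₁ : ℕ) (d'₁ : ℤ) (c₂ d₂ a₂ : ℤ) (A₂ : ℕ) (d'₂ : ℤ),
        0 < A₁ → Int.gcd c₁ (6 * p * A₁) = 1 → Int.gcd d₁ (6 * p * N) = 1 → (d₁ : ℤ) * d'₁ ≡ 1 [ZMOD (A₁ : ℤ)] →
        ratCuspFactor f true c₁ d₁ a₁ A₁ d'₁ ≠ 0 →
        0 < A₂ → Int.gcd c₂ (6 * p * A₂) = 1 → Int.gcd d₂ (6 * p * N) = 1 → (d₂ : ℤ) * d'₂ ≡ 1 [ZMOD (A₂ : ℤ)] →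
        ratCuspFactor f true c₂ d₂ a₂ A₂ d'₂ ≠ 0 →
      ∀ (z₁ : ∀ (k : ℕ) (r : (cyclotomicLevelsRat p (badPlaces c₁ d₁ A₁ N)).Ideals),
          H1 (tateRep W p) ((cyclotomicLevelsRat p (badPlaces c₁ d₁ A₁ N)).level k r.1))
        (x₁ : ∀ (k : ℕ) (r : (cyclotomicLevelsRat p (badPlaces c₁ d₁ A₁ N)).Ideals), CyclotomicField (cycLevel p k r.1) ℚ),
        ZetaBody W p f ι₁ ((q₁ : ℚ) : ℝ) Λ₁ c₁ d₁ a₁ A₁ z₁ x₁ →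
      ∀ (z₂ : ∀ (k : ℕ) (r : (cyclotomicLevelsRat p (badPlaces c₂ d₂ A₂ N)).Ideals),
          H1 (tateRep W p) ((cyclotomicLevelsRat p (badPlaces c₂ d₂ A₂ N)).level k r.1))
        (x₂ : ∀ (k : ℕ) (r : (cyclotomicLevelsRat p (badPlaces c₂ d₂ A₂ N)).Ideals), CyclotomicField (cycLevel p k r.1) ℚ),
        ZetaBody W p f ι₂ ((q₂ : ℚ) : ℝ) Λ₂ c₂ d₂ a₂ A₂ z₂ x₂ →
      ∀ (K : ZpExtension ℚ p) (hK : K.IsCyclotomic) (γ : absoluteGaloisGroup ℚ), K.IsTopGenerator γ →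
      ∀ (I : IwasawaH1Data W p K γ) (y₁ y₂ : I.H),
        (∀ n : ℕ, I.proj n y₁ = levelToLayer W p hK hp (badPlaces c₁ d₁ A₁ N) n
          (z₁ (n + 1) (cyclotomicLevelsRat p (badPlaces c₁ d₁ A₁ N)).idealOne)) →
        (∀ n : ℕ, I.proj n y₂ = levelToLayer W p hK hp (badPlaces c₂ d₂ A₂ N) n
          (z₂ (n + 1) (cyclotomicLevelsRat p (badPlaces c₂ d₂ A₂ N)).idealOne)) →
      ∀ (F G : IwasawaAlgebra p), F • y₁ = G • y₂ →
        (PowerSeries.constantCoeff F ≠ 0 ∨ PowerSeries.constantCoeff G ≠ 0) →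
        e * ((q₁ * ratCuspFactor f true c₁ d₁ a₁ A₁ d'₁ * ∏ ℓ ∈ (p * A₁).primeFactors, eulerFactorAtOne W N ℓ : ℚ) : ℚ_[p]) * ((PowerSeries.constantCoeff F : ℤ_[p]) : ℚ_[p]) =
          ((q₂ * ratCuspFactor f true c₂ d₂ a₂ A₂ d'₂ * ∏ ℓ ∈ (p * A₂).primeFactors, eulerFactorAtOne W N ℓ : ℚ) : ℚ_[p]) * ((PowerSeries.constantCoeff G : ℤ_[p]) : ℚ_[p]) := by
  intro W _ _ p hpr
  letI instC : ContinuousSMul ℤ_[p] (W.tateModule p) := TateModule.continuousSMul_padicInt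
  letI instF : Module.Free ℤ_[p] (W.tateModule p) := W.module_free_tateModule_holds p
  letI instFi : Module.Finite ℤ_[p] (W.tateModule p) := W.module_finite_tateModule_holds p
  intro hp N _ f hnf ι₁ ι₂ q₁ q₂ Λ₁ Λ₂ e _hq₁ _hq₂ _he hΛ c₁ d₁ a₁ A₁ d'₁ c₂ d₂ a₂ A₂ d'₂ hA₁ hc₁ hd₁ hdd₁ _hR₁ hA₂ hc₂ hd₂
    hdd₂ _hR₂ z₁ x₁ hζ₁ z₂ x₂ hζ₂ K hK γ hγ I y₁ y₂ hy₁ hy₂ F G hFG _hprim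
  -- the guards `(cᵢ, p) = (dᵢ, p) = 1`
  have hcp₁ : IsCoprime c₁ (p : ℤ) := ((Int.isCoprime_iff_gcd_eq_one.mpr hc₁).of_mul_right_left).of_mul_right_right
  have hdp₁ : IsCoprime d₁ (p : ℤ) := ((Int.isCoprime_iff_gcd_eq_one.mpr hd₁).of_mul_right_left).of_mul_right_right
  have hcp₂ : IsCoprime c₂ (p : ℤ) := ((Int.isCoprime_iff_gcd_eq_one.mpr hc₂).of_mul_right_left).of_mul_right_right
  have hdp₂ : IsCoprime d₂ (p : ℤ) := ((Int.isCoprime_iff_gcd_eq_one.mpr hd₂).of_mul_right_left).of_mul_right_right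
  -- E44: the Iwasawa functions reading the explicit numbers of the two families
  obtain ⟨v₁, Φ₁, hΦ₁0, hΦ₁⟩ := exists_iwasawaFunction_reads_explicitValues hγ W hnf q₁ a₁ A₁ d'₁ hcp₁ hdp₁
  obtain ⟨v₂, Φ₂, hΦ₂0, hΦ₂⟩ := exists_iwasawaFunction_reads_explicitValues hγ W hnf q₂ a₂ A₂ d'₂ hcp₂ hdp₂
  -- per level `n`: a frame rotation `ι₂ ∘ σ_{a_n} = ι₁` realised in `Gal(ℚ̄/ℚ)`, and a `ℚ_p`-algebra map `ℚ_p ⊗ ℚ(ζ_{p^{n+1}}) → ℂ_p`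
  have hdata : ∀ n : ℕ, ∃ (a : (ZMod (cycLevel p (n + 1) ∅))ˣ) (σ : absoluteGaloisGroup ℚ)
      (ψ : ℚ_[p] ⊗[ℚ] CyclotomicField (cycLevel p (n + 1) ∅) ℚ →ₐ[ℚ_[p]] ℂ_[p])
      (j : CyclotomicField (cycLevel p (n + 1) ∅) ℚ →+* ℂ_[p]),
      (∀ y, ι₂ (cycLevel p (n + 1) ∅) (sigma (cycLevel p (n + 1) ∅) a y) = ι₁ (cycLevel p (n + 1) ∅) y) ∧
      ((modNCyclotomicCharacter ℚ (cycLevel p (n + 1) ∅) σ : (ZMod (cycLevel p (n + 1) ∅))ˣ) :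
        ZMod (cycLevel p (n + 1) ∅)) = (a : ZMod (cycLevel p (n + 1) ∅)) ∧
      ∀ x : CyclotomicField (cycLevel p (n + 1) ∅) ℚ, ψ ((1 : ℚ_[p]) ⊗ₜ[ℚ] x) = j x := by
    intro n
    obtain ⟨a, ha⟩ := exists_units_ringHom_comp_sigma_eq (ι₁ (cycLevel p (n + 1) ∅)) (ι₂ (cycLevel p (n + 1) ∅))
    obtain ⟨σ, hσ⟩ := Rat.modNCyclotomicCharacter_surjective (cycLevel p (n + 1) ∅) a
    obtain ⟨ψ, j, hψ⟩ := exists_algHom_tensor_cyclotomicField_padicComplex (p := p) (cycLevel p (n + 1) ∅)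
    exact ⟨a, σ, ψ, j, ha, congrArg Units.val hσ, hψ⟩
  choose a σ ψ j ha hσ hψ using hdata
  -- E45: a cluster value `β*` of the exponents `κ(σ_n)` (compactness of `ℤ_p`)
  obtain ⟨β, hβ⟩ := exists_clusterPt_pow_dvd (p := p) (fun n ↦ Multiplicative.toAdd (K (σ n)))
  -- Rohrlich's bound: `L(f, χ, 1) ≠ 0` for the faithful characters of `Γ_k`, `k ≥ B`
  obtain ⟨B, hB⟩ := exists_bound_continuation_one_ne_zero (p := p) hnf.1
    (Summit.BirchSwinnertonDyer.BirchSwinnertonDyer.Theorems.PSRohrlichAtLevel.rohrlich_primePow_of_isNewformOf (p := p) hnf)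
  -- E46: for every `k`, a point of exact order `p^{B+k}` where the two Iwasawa functions take a common value
  have hpt : ∀ k : ℕ, ∃ z : ℂ_[p], IsPrimitiveRoot (z + 1) (p ^ (B + k)) ∧ ‖z‖ < 1 ∧ ∃ w : ℂ_[p],
      HasSum (fun i ↦ algebraMap ℚ_[p] ℂ_[p] (PowerSeries.coeff i
        (PowerSeries.C e * PowerSeries.map (algebraMap ℤ_[p] ℚ_[p])
          (PowerSeries.C ((p : ℤ_[p]) ^ v₂) * F * Φ₁))) * z ^ i) w ∧
      HasSum (fun i ↦ algebraMap ℚ_[p] ℂ_[p] (PowerSeries.coeff i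
        (PowerSeries.map (algebraMap ℤ_[p] ℚ_[p])
          (PowerSeries.C ((p : ℤ_[p]) ^ v₁) * G * Φ₂ * PowerSeries.binomialSeries ℤ_[p] β))) * z ^ i) w := by
    intro k
    obtain ⟨n, hkn, hdiv⟩ := hβ (B + k) (B + k)
    obtain ⟨χ₀, hker⟩ := exists_layerCharacter_prime_pow hp (B + k)
    have hMn : cycLevel p (n + 1) ∅ = p ^ (n + 1) := by simp [cycLevel]
    have hdvd : p ^ (B + k + 1) ∣ cycLevel p (n + 1) ∅ := by
      rw [hMn]
      exact pow_dvd_pow p (by omega)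
    obtain ⟨L₀, hL₀d, hL₀s⟩ :=
      exists_differentiable_eq_twistedLSeries_holds f (m := cycLevel p (n + 1) ∅) (DirichletCharacter.changeLevel hdvd χ₀)
    have hL : L₀ 1 ≠ 0 := hB (B + k) (Nat.le_add_right B k) hker hMn hdvd L₀ hL₀d hL₀s
    exact exists_point_hasSum_eq hp hnf hΛ hA₁ hc₁ hd₁ hdd₁ hA₂ hc₂ hd₂ hdd₂ hζ₁ hζ₂ hK hγ I hy₁ hy₂ hFG hΦ₁ hΦ₂
      hkn hker hdvd hL₀d hL₀s hL (ha n) (hσ n) (dvd_sub_comm.mp hdiv) (hψ n)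
  choose zpt hzpt using hpt
  -- the points are pairwise distinct (orders `p^{B+k}`), hence infinitely many
  have hinj : Function.Injective zpt := by
    intro k₁ k₂ h
    have h1 := (hzpt k₁).1
    rw [h] at h1
    have h2 : p ^ (B + k₁) = p ^ (B + k₂) := h1.unique (hzpt k₂).1
    have h3 := Nat.pow_right_injective hpr.out.two_le h2
    omega
  -- E40: separation in `Λ ⊗ ℚ_p`
  have hGH := eq_of_infinite_agree
    ((memIwasawaRat_iwasawaToPowerSeries p (PowerSeries.C ((p : ℤ_[p]) ^ v₂) * F * Φ₁)).C_mul e)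
    (memIwasawaRat_iwasawaToPowerSeries p
      (PowerSeries.C ((p : ℤ_[p]) ^ v₁) * G * Φ₂ * PowerSeries.binomialSeries ℤ_[p] β))
    (Set.infinite_range_of_injective hinj) (fun z hz => by
      obtain ⟨k, rfl⟩ := hz
      exact (hzpt k).2)
  -- constant terms
  have h0 := congrArg PowerSeries.constantCoeff hGH
  simp only [map_mul, PowerSeries.constantCoeff_C, constantCoeff_iwasawaToPowerSeries,
    PowerSeries.binomialSeries_constantCoeff, PadicInt.coe_pow, PadicInt.coe_natCast, hΦ₁0, hΦ₂0] at h0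
  -- `p ∣ p·Aᵢ`: split off the Euler factor at `p`
  have hp₁ : p ∈ (p * A₁).primeFactors :=
    Nat.mem_primeFactors.mpr ⟨hpr.out, dvd_mul_right p A₁, mul_ne_zero hpr.out.ne_zero hA₁.ne'⟩
  have hp₂ : p ∈ (p * A₂).primeFactors :=
    Nat.mem_primeFactors.mpr ⟨hpr.out, dvd_mul_right p A₂, mul_ne_zero hpr.out.ne_zero hA₂.ne'⟩
  rw [← Finset.mul_prod_erase (p * A₁).primeFactors (fun ℓ => eulerFactorAtOne W N ℓ) hp₁,
    ← Finset.mul_prod_erase (p * A₂).primeFactors (fun ℓ => eulerFactorAtOne W N ℓ) hp₂]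
  have hp0 : (p : ℚ_[p]) ≠ 0 := Nat.cast_ne_zero.mpr hpr.out.ne_zero
  push_cast at h0 ⊢
  refine mul_left_cancel₀ (mul_ne_zero (pow_ne_zero v₁ hp0) (pow_ne_zero v₂ hp0)) ?_
  linear_combination ((eulerFactorAtOne W N p : ℚ) : ℚ_[p]) * h0

set_option backward.isDefEq.respectTransparency false in
set_option maxHeartbeats 1600000 in
/-- ★ **KATO-RIGID from Kato's Thm. 12.4 (2) alone** (E28 `katoRigid_of_thm12_4_of_aug` fed with the theorem `aug`): the bottom
`loc_p`-Kummer logarithms of the lifts of two Kato families of a curve are proportional with the ratio displayed by AUG.  CONDITIONAL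
on `Kato2004.thm12_4` (a named fact of the tree); no stub closed; nothing asserted on 19945 / 19223; BSD is not proved for any curve.
[cite: Kato2004Asterisque, Thm. 12.4 (2) (p. 221) and §13.9–Lemma 13.10 (pp. 229–230)] [cite: BlochKato1990, Prop. 3.8] -/
theorem katoRigid_of_thm12_4 (h12 : Kato2004.thm12_4) :
    ∀ (W : WeierstrassCurve ℚ) [W.IsElliptic] [W.IsGloballyMinimal] (p : ℕ) [Fact p.Prime],
      letI : ContinuousSMul ℤ_[p] (W.tateModule p) := TateModule.continuousSMul_padicInt
      letI : Module.Free ℤ_[p] (W.tateModule p) := W.module_free_tateModule_holds p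
      letI : Module.Finite ℤ_[p] (W.tateModule p) := W.module_finite_tateModule_holds p
      ∀ (hp : p ≠ 2) {N : ℕ} [NeZero N] (f : CuspForm (Gamma0 N) 2), IsNewformOf W f →
      ∀ (ι₁ ι₂ : (n : ℕ) → (CyclotomicField n ℚ →+* ℂ)) (q₁ q₂ : ℚ)
        (Λ₁ Λ₂ : ∀ (k : ℕ) (r : Finset (HeightOneSpectrum (𝓞 ℚ))),
          H1 (tateRep W p) (cycSubgroup p k r) →ₗ[ℤ_[p]] ℚ_[p] ⊗[ℚ] CyclotomicField (cycLevel p k r) ℚ) (e : ℚ_[p]),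
        q₁ ≠ 0 → q₂ ≠ 0 → e ≠ 0 → (∀ (k : ℕ) (y : H1 (tateRep W p) (cycSubgroup p k ∅)), Λ₂ k ∅ y = e • Λ₁ k ∅ y) →
      ∀ (c₁ d₁ a₁ : ℤ) (A₁ : ℕ) (d'₁ : ℤ) (c₂ d₂ a₂ : ℤ) (A₂ : ℕ) (d'₂ : ℤ),
        0 < A₁ → Int.gcd c₁ (6 * p * A₁) = 1 → Int.gcd d₁ (6 * p * N) = 1 → (d₁ : ℤ) * d'₁ ≡ 1 [ZMOD (A₁ : ℤ)] →
        ratCuspFactor f true c₁ d₁ a₁ A₁ d'₁ ≠ 0 →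
        0 < A₂ → Int.gcd c₂ (6 * p * A₂) = 1 → Int.gcd d₂ (6 * p * N) = 1 → (d₂ : ℤ) * d'₂ ≡ 1 [ZMOD (A₂ : ℤ)] →
        ratCuspFactor f true c₂ d₂ a₂ A₂ d'₂ ≠ 0 →
      ∀ (z₁ : ∀ (k : ℕ) (r : (cyclotomicLevelsRat p (badPlaces c₁ d₁ A₁ N)).Ideals),
          H1 (tateRep W p) ((cyclotomicLevelsRat p (badPlaces c₁ d₁ A₁ N)).level k r.1))
        (x₁ : ∀ (k : ℕ) (r : (cyclotomicLevelsRat p (badPlaces c₁ d₁ A₁ N)).Ideals), CyclotomicField (cycLevel p k r.1) ℚ),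
        ZetaBody W p f ι₁ ((q₁ : ℚ) : ℝ) Λ₁ c₁ d₁ a₁ A₁ z₁ x₁ →
      ∀ (z₂ : ∀ (k : ℕ) (r : (cyclotomicLevelsRat p (badPlaces c₂ d₂ A₂ N)).Ideals),
          H1 (tateRep W p) ((cyclotomicLevelsRat p (badPlaces c₂ d₂ A₂ N)).level k r.1))
        (x₂ : ∀ (k : ℕ) (r : (cyclotomicLevelsRat p (badPlaces c₂ d₂ A₂ N)).Ideals), CyclotomicField (cycLevel p k r.1) ℚ),
        ZetaBody W p f ι₂ ((q₂ : ℚ) : ℝ) Λ₂ c₂ d₂ a₂ A₂ z₂ x₂ →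
      ∀ (K : ZpExtension ℚ p) (hK : K.IsCyclotomic) (γ : absoluteGaloisGroup ℚ), K.IsTopGenerator γ →
      ∀ (I : IwasawaH1Data W p K γ) (y₁ y₂ : I.H),
        (∀ n : ℕ, I.proj n y₁ = levelToLayer W p hK hp (badPlaces c₁ d₁ A₁ N) n
          (z₁ (n + 1) (cyclotomicLevelsRat p (badPlaces c₁ d₁ A₁ N)).idealOne)) →
        (∀ n : ℕ, I.proj n y₂ = levelToLayer W p hK hp (badPlaces c₂ d₂ A₂ N) n
          (z₂ (n + 1) (cyclotomicLevelsRat p (badPlaces c₂ d₂ A₂ N)).idealOne)) →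
      ∀ (t₁ t₂ : ℚ_[p]), HasLocPKummerLog W p (layerZeroToTop W p K (I.proj 0 y₁)) t₁ →
        HasLocPKummerLog W p (layerZeroToTop W p K (I.proj 0 y₂)) t₂ →
        e * ((q₁ * ratCuspFactor f true c₁ d₁ a₁ A₁ d'₁ * ∏ ℓ ∈ (p * A₁).primeFactors, eulerFactorAtOne W N ℓ : ℚ) : ℚ_[p]) * t₂ =
          ((q₂ * ratCuspFactor f true c₂ d₂ a₂ A₂ d'₂ * ∏ ℓ ∈ (p * A₂).primeFactors, eulerFactorAtOne W N ℓ : ℚ) : ℚ_[p]) * t₁ :=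
  katoRigid_of_thm12_4_of_aug h12 aug

set_option backward.isDefEq.respectTransparency false in
/-- ★ **PR-INV = stub 3 (A2's `hPRinv`, verbatim) from `IsNewformOf.level_eq_conductorNorm` and Kato's Thm. 12.4 (2)** (E29
`prInv_of_lev_of_thm12_4_of_aug` fed with the theorem `aug`): two Kato–Perrin-Riou classes `ℒ₁, ℒ₂` of a curve (the tree's
`Kato2004.PRRatio`) differ by a `p`-adic unit.  CONDITIONAL on the two named hypotheses; no stub closed unconditionally; nothing asserted
on 19945 / 19223; Perrin-Riou's conjecture is untouched; BSD is not proved for any curve.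
[cite: Kato2004Asterisque, Thm. 12.4 (2) (p. 221), Thm. 12.5 (p. 222), §13.9–Lemma 13.10 (pp. 229–230)] -/
theorem prInv_of_lev_of_thm12_4
    (hlev : ∀ (N : ℕ) [NeZero N], IsNewformOf.level_eq_conductorNorm (N := N)) (h12 : Kato2004.thm12_4) :
    ∀ (W : WeierstrassCurve ℚ) [W.IsElliptic] [W.IsGloballyMinimal] (p : ℕ) [Fact p.Prime]
      (ℒ₁ ℒ₂ : ℚ_[p]), Kato2004.PRRatio W p ℒ₁ → Kato2004.PRRatio W p ℒ₂ → ∃ w : ℚ_[p], ‖w‖ = 1 ∧ ℒ₂ = w * ℒ₁ :=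
  prInv_of_lev_of_thm12_4_of_aug hlev h12 aug

end Summit.BirchSwinnertonDyer.Rank1Residual.Additive.PerrinRiouUnit

end
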